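import Literature.Computability.Complexity.FKPointLocationLevel
import HarnessLib

/-!
# Fournier–Koiran point location, IV′: an explicit choice of the level parameters

Topic `Literature/Computability/Complexity`, grouping namespace `FKPointLocation`. The inequalities of
`LevelParams` (`FKPointLocationLevel.lean`: coarseness at the largest scale, nearness of the
generalized-inverse solution, `ρ_{D+1} ≤ 1`, width of the apexes) are satisfied by CRUDE
polynomial-size exponents in the dimension `D = n+1` and the coefficient exponent `β`
(`B = 2^β`): `paramsOf n β`, with `κ = D² + (β+2)(D+1) + 6`, `L = κ(D+1) + D² + 3D + 2 + β(D+2)`,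
`W = (L + 1 + D² + βD) + (D² + 2D + βD + β + κD) + 2` — all of them polynomials in `n` and `β`,
which is what makes the number of rounds and the sizes of the location procedure polynomial
(report §2.2: "the length of these coefficients is polynomial in `n`"; the value
`1/r_n = n^{n²} 2^{2n² t(n) + O(n²)}`).

## References

* H. Fournier, P. Koiran, *Lower bounds are not easier over the reals: inside PH*, ICALP 2000,
  LNCS 1853 = LIP RR-1999-21, §2.1 (value of `r_n`), §2.2 (polynomial size of all coefficients).
  [FournierKoiran2000]
-/

namespace Literature.Computability.Complexity

namespace FKPointLocation

/-! ### Crude bounds by powers of two -/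

/-- `m ≤ 2^m`. [folklore] -/
private theorem le_two_pow_self (m : ℕ) : m ≤ 2 ^ m := (Nat.lt_two_pow_self).le

/-- `m! ≤ 2^{m·m}`. [folklore] -/
private theorem factorial_le_two_pow_sq (m : ℕ) : m.factorial ≤ 2 ^ (m * m) := by
  calc m.factorial ≤ m ^ m := Nat.factorial_le_pow m
    _ ≤ (2 ^ m) ^ m := Nat.pow_le_pow_left (le_two_pow_self m) m
    _ = 2 ^ (m * m) := by rw [← pow_mul]

/-- `detBound D (2^β) ≤ 2^{D² + βD}`. [folklore] -/
theorem detBound_le (D β : ℕ) : detBound D (2 ^ β) ≤ 2 ^ (D * D + β * D) := by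
  unfold detBound
  rw [max_eq_left (Nat.one_le_two_pow), pow_add, ← pow_mul]
  exact Nat.mul_le_mul (factorial_le_two_pow_sq D) le_rfl

/-- `rowBound D (2^β) ≤ 2^{D + D² + βD}`. [folklore] -/
theorem rowBound_le (D β : ℕ) : rowBound D (2 ^ β) ≤ 2 ^ (D + (D * D + β * D)) := by
  unfold rowBound
  rw [pow_add]
  exact Nat.mul_le_mul (le_two_pow_self D) (detBound_le D β)

/-! ### The parameters -/

/-- The scale exponent. [folklore] -/
def κOf (n β : ℕ) : ℕ := (n + 1) * (n + 1) + (β + 2) * (n + 2) + 6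

/-- The binary-search depth (minus one). [folklore] -/
def LOf (n β : ℕ) : ℕ := κOf n β * (n + 2) + ((n + 1) * (n + 1) + 3 * (n + 1) + 2 + β * (n + 3))

/-- The apex width. [folklore] -/
def WOf (n β : ℕ) : ℕ :=
  (LOf n β + 1 + (n + 1) * (n + 1) + β * (n + 1)) + ((n + 1) * (n + 1) + 2 * (n + 1) + β * (n + 1) + β + κOf n β * (n + 1)) + 2

/-- **Explicit level parameters** in dimension `D = n+1` with coefficient bound `B = 2^β`.
[cite: FournierKoiran2000, §2.1–2.2 (the choice of `r_n` and the polynomial size of all coefficients)] -/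
def paramsOf (n β : ℕ) : LevelParams where
  D := n + 1
  B := 2 ^ β
  L := LOf n β
  κ := κOf n β
  W := WOf n β
  D_pos := Nat.succ_pos n
  one_le_B := Nat.one_le_two_pow
  coarse := by
    -- `D B 2^{κ(D+1)} (1 + D²B)(D! B^D) ≤ 2^{κ(D+1) + D² + 3D + 1 + β(D+2)} < 2^{L+1}`
    set D := n + 1 with hD
    have h1 : D ≤ 2 ^ D := le_two_pow_self D
    have h2 : 1 + D * D * 2 ^ β ≤ 2 ^ (2 * D + β + 1) := by
      have hDD : D * D ≤ 2 ^ (2 * D) := by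
        calc D * D ≤ 2 ^ D * 2 ^ D := Nat.mul_le_mul h1 h1
          _ = 2 ^ (2 * D) := by rw [← pow_add]; ring_nf
      have : D * D * 2 ^ β ≤ 2 ^ (2 * D + β) := by rw [pow_add]; exact Nat.mul_le_mul_right _ hDD
      have hpos : 1 ≤ 2 ^ (2 * D + β) := Nat.one_le_two_pow
      rw [pow_succ]; omega
    have h3 : (D.factorial * (2 ^ β) ^ D) ≤ 2 ^ (D * D + β * D) := by
      have := detBound_le D β; unfold detBound at this; rwa [max_eq_left (Nat.one_le_two_pow)] at this
    have hprod : D * 2 ^ β * 2 ^ (κOf n β * (D + 1)) * ((1 + D * D * 2 ^ β) * (D.factorial * (2 ^ β) ^ D)) ≤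
        2 ^ (D + β + κOf n β * (D + 1) + ((2 * D + β + 1) + (D * D + β * D))) := by
      calc D * 2 ^ β * 2 ^ (κOf n β * (D + 1)) * ((1 + D * D * 2 ^ β) * (D.factorial * (2 ^ β) ^ D))
          ≤ 2 ^ D * 2 ^ β * 2 ^ (κOf n β * (D + 1)) * (2 ^ (2 * D + β + 1) * 2 ^ (D * D + β * D)) :=
            Nat.mul_le_mul (Nat.mul_le_mul (Nat.mul_le_mul h1 le_rfl) le_rfl) (Nat.mul_le_mul h2 h3)
        _ = _ := by simp only [← pow_add]
    refine lt_of_le_of_lt hprod (Nat.pow_lt_pow_right (by norm_num) ?_)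
    show D + β + κOf n β * (D + 1) + (2 * D + β + 1 + (D * D + β * D)) < LOf n β + 1
    simp only [LOf, hD]
    ring_nf
    omega
  near := by
    set D := n + 1 with hD
    have h1 : D ≤ 2 ^ D := le_two_pow_self D
    have hprod : 8 * (rowBound D (2 ^ β) * (D * 2 ^ β)) ≤ 2 ^ (3 + ((D + (D * D + β * D)) + (D + β))) := by
      calc 8 * (rowBound D (2 ^ β) * (D * 2 ^ β)) ≤ 2 ^ 3 * (2 ^ (D + (D * D + β * D)) * (2 ^ D * 2 ^ β)) :=
            Nat.mul_le_mul (by norm_num) (Nat.mul_le_mul (rowBound_le D β) (Nat.mul_le_mul h1 le_rfl))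
        _ = _ := by simp only [← pow_add]
    refine hprod.trans (Nat.pow_le_pow_right (by norm_num) ?_)
    show 3 + (D + (D * D + β * D) + (D + β)) ≤ κOf n β
    simp only [κOf, hD]
    ring_nf
    omega
  three_le := by unfold κOf; omega
  small := Nat.pow_le_pow_right (by norm_num) (by unfold LOf; ring_nf; omega)
  width := by
    set D := n + 1 with hD
    have h1 : D ≤ 2 ^ D := le_two_pow_self D
    have hA : 2 ^ (LOf n β + 1) * detBound D (2 ^ β) ≤ 2 ^ (LOf n β + 1 + (D * D + β * D)) := by
      rw [pow_add 2 (LOf n β + 1)]; exact Nat.mul_le_mul_left _ (detBound_le D β)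
    have hB : rowBound D (2 ^ β) * (D * 2 ^ β * 2 ^ (κOf n β * D)) ≤
        2 ^ ((D + (D * D + β * D)) + (D + β + κOf n β * D)) := by
      calc rowBound D (2 ^ β) * (D * 2 ^ β * 2 ^ (κOf n β * D))
          ≤ 2 ^ (D + (D * D + β * D)) * (2 ^ D * 2 ^ β * 2 ^ (κOf n β * D)) :=
            Nat.mul_le_mul (rowBound_le D β) (Nat.mul_le_mul (Nat.mul_le_mul h1 le_rfl) le_rfl)
        _ = _ := by simp only [← pow_add]
    have hW1 : LOf n β + 1 + (D * D + β * D) ≤ WOf n β - 2 := by simp only [WOf, hD]; ring_nf; omega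
    have hW2 : (D + (D * D + β * D)) + (D + β + κOf n β * D) ≤ WOf n β - 2 := by simp only [WOf, hD]; ring_nf; omega
    have h2W : 2 ≤ WOf n β := by unfold WOf; omega
    calc 2 ^ (LOf n β + 1) * detBound D (2 ^ β) + rowBound D (2 ^ β) * (D * 2 ^ β * 2 ^ (κOf n β * D))
        ≤ 2 ^ (WOf n β - 2) + 2 ^ (WOf n β - 2) :=
          Nat.add_le_add (hA.trans (Nat.pow_le_pow_right (by norm_num) hW1)) (hB.trans (Nat.pow_le_pow_right (by norm_num) hW2))
      _ = 2 ^ (WOf n β - 1) := by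
          have : WOf n β - 1 = (WOf n β - 2) + 1 := by omega
          rw [this, pow_succ]; ring
      _ < 2 ^ WOf n β := Nat.pow_lt_pow_right (by norm_num) (by omega)

/-- The fields of `paramsOf`. [folklore] -/
@[simp] theorem paramsOf_D (n β : ℕ) : (paramsOf n β).D = n + 1 := rfl
/-- Field of `paramsOf` (definitional). [folklore] -/
@[simp] theorem paramsOf_B (n β : ℕ) : (paramsOf n β).B = 2 ^ β := rfl
/-- Field of `paramsOf` (definitional). [folklore] -/
@[simp] theorem paramsOf_L (n β : ℕ) : (paramsOf n β).L = LOf n β := rfl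
/-- Field of `paramsOf` (definitional). [folklore] -/
@[simp] theorem paramsOf_κ (n β : ℕ) : (paramsOf n β).κ = κOf n β := rfl
/-- Field of `paramsOf` (definitional). [folklore] -/
@[simp] theorem paramsOf_W (n β : ℕ) : (paramsOf n β).W = WOf n β := rfl

/-! ### Polynomial size of the parameters -/

/-- `κ ≤ (β+4)(n+3)²`. [folklore] -/
theorem κOf_le (n β : ℕ) : κOf n β ≤ (β + 4) * (n + 3) ^ 2 := by
  unfold κOf; ring_nf; nlinarith [Nat.zero_le n, Nat.zero_le β, Nat.zero_le (n * β), Nat.zero_le (n*n)]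

/-- `L ≤ 2(β+4)(n+3)³`. [folklore] -/
theorem LOf_le (n β : ℕ) : LOf n β ≤ 2 * (β + 4) * (n + 3) ^ 3 := by
  have hκ := κOf_le n β
  unfold LOf
  have h1 : κOf n β * (n + 2) ≤ (β + 4) * (n + 3) ^ 2 * (n + 3) := Nat.mul_le_mul hκ (by omega)
  have h2 : (n + 1) * (n + 1) + 3 * (n + 1) + 2 + β * (n + 3) ≤ (β + 4) * (n + 3) ^ 3 := by
    ring_nf; nlinarith [Nat.zero_le n, Nat.zero_le β, Nat.zero_le (n * β), Nat.zero_le (n*n), Nat.zero_le (n*n*β), Nat.zero_le (n*n*n)]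
  calc _ ≤ (β + 4) * (n + 3) ^ 2 * (n + 3) + (β + 4) * (n + 3) ^ 3 := Nat.add_le_add h1 h2
    _ = 2 * (β + 4) * (n + 3) ^ 3 := by ring

/-- `W ≤ 8(β+4)(n+3)³`. [folklore] -/
theorem WOf_le (n β : ℕ) : WOf n β ≤ 8 * (β + 4) * (n + 3) ^ 3 := by
  have hκ := κOf_le n β
  have hL := LOf_le n β
  unfold WOf
  have h1 : (n + 1) * (n + 1) + β * (n + 1) ≤ (β + 4) * (n + 3) ^ 3 := by
    ring_nf; nlinarith [Nat.zero_le n, Nat.zero_le β, Nat.zero_le (n * β), Nat.zero_le (n*n), Nat.zero_le (n*n*β), Nat.zero_le (n*n*n)]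
  have h2 : (n + 1) * (n + 1) + 2 * (n + 1) + β * (n + 1) + β ≤ (β + 4) * (n + 3) ^ 3 := by
    ring_nf; nlinarith [Nat.zero_le n, Nat.zero_le β, Nat.zero_le (n * β), Nat.zero_le (n*n), Nat.zero_le (n*n*β), Nat.zero_le (n*n*n)]
  have h3 : κOf n β * (n + 1) ≤ (β + 4) * (n + 3) ^ 3 := by
    calc κOf n β * (n + 1) ≤ (β + 4) * (n + 3) ^ 2 * (n + 3) := Nat.mul_le_mul hκ (by omega)
      _ = (β + 4) * (n + 3) ^ 3 := by ring
  have h4 : 1 + 2 ≤ (β + 4) * (n + 3) ^ 3 := by nlinarith [Nat.zero_le n, Nat.zero_le β]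
  nlinarith [h1, h2, h3, h4, hL]

end FKPointLocation

end Literature.Computability.Complexity
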